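import Summits.HodgeConjecture.CorCM.HypLiu418.A3Liu418Items
import Summits.HodgeConjecture.CorCM.HypLiu418.A3Liu418EtaleItems
import Summits.HodgeConjecture.CorCM.HypLiu418.A3Liu418MainIsoOfEtaleItems
import Summits.HodgeConjecture.CorCM.HypLiu418.A3Liu418MainGaloisTransport
import Summits.HodgeConjecture.CorCM.D2Bridge.PrintedCitationHypothesesT
import Literature.NumberTheory.Automorphic.Liu2021.Thm418GaloisBlocksOfEpsRigid
import Literature.NumberTheory.Automorphic.Liu2021.Thm418EpsRigidUnderGaloisTwist
import Literature.FieldTheory.AlgClosed.PadicAlgClEquivComplex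
import HarnessLib

/-!
# [Liu 2021, Thm 4.18] MAIN ISOMORPHISM + item (3) at the CONJUGATE SPACE's transported datum `D′` — the GLUE of Liu's ℓ-adic proof:
# stub G `stub_mainGaloisGlue` of `Lines/a3-liu418.lean` v3 1b96ade3f8b6b529, CLOSED MODULO `h21` and ε-RIGIDITY UNDER GALOIS TWIST (row III-11)

Cell `hodgecm-mathlib` (D-0151), fan A, rung A-III, skeleton `Lines/a3-liu418.lean` v3 (sha16 1b96ade3f8b6b529, REF1 PASS 2026-08-28T02:21:45Z),
registered stub `stub_mainGaloisGlue : StubMainGaloisGlue` (:607 ∕ :705; KEY `a3-main-galois-glue`, strategy «isotypic cut-out by Schur + multiplicity one,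
then transport along MuConjIdent»).  Seat prover-hodgecm-mathlib-A-p19, 2026-08-28.

`StubMainGaloisGlue` is: from [Def 4.11] for `V`'s family (`Hyp411`), for every face prefix `(hDel, F, ι₁, V, a, Φ, hΦ, ν, hν, hw, Φ′)` under the space
identification (`SpaceIdent`) — GIVEN at every `(ℓ, ι_ℓ)` an étale Hecke datum `X` induced by the Albanese translates with its Betti theta decomposition
[Prop 4.13] (`EtaleThetaDecomposition`), the Faltings identification (`FaltingsIsotypic`), [Thm 4.15] pinned at `ν` (`Thm415Pinned`, every object) and the
Galois separation of labels (`GaloisLabelSeparation`), and GIVEN item (2) (`NonIso`) at `D′` — the MAIN STATEMENT + item (3) of [Liu2021, Thm 4.18]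
(`MainGalois`) at `D′ = datumC … = (toThm418Data ℭ_V ((muConj 𝕌_V).rest t_ν)).transport 𝔾_{V^c} (adelicFinConj V̂)⁻¹ Eps (epsOf δ′) Chi
(𝕌_{V^c}.omega ν hν) (𝕌_{V^c}.rho ν hν)`.  Here the stub type is stated BY NAME over the tree copies of the skeleton's own declarations
(✔ `A3Liu418EtaleItems.lean`, A-p06 p598646: `AdmTripleAll`, `EtaleThetaDecomposition`, `FaltingsIsotypic`, `GaloisLabelSeparation`; `A3Liu418Items.lean`,
A-p19: `MainGalois`, `NonIso`, `datumC`, `SpaceIdent`, `CV`, `TV`, `UV`, `CarN`) and the pack decl of record `PrintedCitationHypotheses.Hyp411`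
(`D2Bridge/PrintedCitationHypothesesT.lean`, character-identical to the skeleton's local `Hyp411`) — so the text below IS `StubMainGaloisGlue` once the
skeleton imports those modules (A-plan2, v4).

THIS FILE proves it (`stub_mainGaloisGlue_of`) from TWO extra hypotheses in front, both reported for re-threading:
* `h21 : shimura1998_thm21_4_casselman` — the headline's binder #2 ([Shimura1998, Thm 21.4]); it supplies `𝒜(ν) ≠ ∅` ([Liu2021, Prop 4.6 (1)],
  ✔ `Def45.nonempty_cmDatum_polDR_rMuForm_of_casselman`).  Without an object `D_ν` the Faltings hypothesis is vacuous and `Ω(ν) = ∏_∅ = 0`, so the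
  stub as typed is not provable; the END slot has `h21` in scope (the skeleton's audit `example` binds it), exactly as for A-p18's stub S.
* `hGT : ∀ ⟨face prefix⟩, (D₀).EpsRigidUnderGaloisTwist` — **ε-RIGIDITY UNDER GALOIS TWIST** (B-typ04's named fact ✔
  `Literature.NumberTheory.Automorphic.Liu2021.Thm418Data.EpsRigidUnderGaloisTwist`, p600012, row III-11 (G2), director ruling 2026-08-28T02:56:13Z) at
  `V`'s own datum `D₀ := toThm418Data ℭ_V ((muConj 𝕌_V).rest t_ν)`: for `σ ∈ Aut(ℂ/M_ν)`, a `σ`-semilinear `𝔾`-equivariant bijection `ω_i → ω_j` of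
  admissible summands forces `i.ε = j.ε`.  This is the content of Liu's own proof of item (3) (FJcycle.tex l. 2272–2290); it is NOT derivable from the v3
  hypotheses of the stub (they carry no `ε`-information under `σ`).

KERNEL: `ℓ := 2`, `ι_2 : ℂ ≃+* ℚ_2^{ac}` by ✔ `Complex.nonempty_ringEquiv_padicAlgCl`; (G1) ✔ `exists_mainIso_of_etaleItems`
(`A3Liu418MainIsoOfEtaleItems.lean`, p603097) at `(ℭ_V, muConj 𝕌_V, 𝕋_V, AlgHom.id, ι₁, ν, CarN)` with the object of `𝒜(ν)` from `h21` and irreducibility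
of every `ω_{muConj 𝕌_V}(μ′,ε,χ) = ω_V(μ′ᶜ,ε,χ)` from `Hyp411` at `μ′ᶜ` (✔ `restOfCharRep_eq_rest`: `V`'s printed rest IS `𝕌_V.rest (restTailOne …)`);
(G2) ✔ `Thm418Data.epsBlock_galoisAct_stable_of_epsRigid` (`Thm418GaloisBlocksOfEpsRigid.lean`, p600635) at `D₀`; (G3) ✔ `mainGalois_transport_hermConj`
(`A3Liu418MainGaloisTransport.lean`, p603328).  `SpaceIdent` and `NonIso` are not used (carried as typed).  Item (2) is NOT an input of (G1)–(G3).
ORIENTATION: none chosen here — the sign S1 (A-plan/A3-ORIENTATION.md §3) enters only through the HYPOTHESIS `Thm415Pinned … ν …`.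
HC_CM is proved only modulo the 7 printed citations (`hDel`, `h21`, `hLiu418`, `h411`, `h413`, `hD3`, `hD1''`) until rung 0 closes; nothing of [Liu2021]
is asserted here: [Def 4.11], [Prop 4.13], [Thm 4.15], Faltings, the separation, item (2), `h21` and the ε-rigidity are HYPOTHESES.

References: [Liu2021] Y. Liu, *Fourier–Jacobi cycles and arithmetic relative trace formula*, Camb. J. Math. 9 (2021) = arXiv:2102.11518, Thm. 4.18 with
proof (FJcycle.tex l. 2232–2290), Def. 4.11–4.12, Prop. 4.13, Thm 4.15, Def. 4.16, Rem. 4.17, Prop. 4.6 (1); [Shimura1998] G. Shimura, *Abelian varieties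
with complex multiplication and modular functions*, Thm. 21.4; [BushnellHenniart2006] §41.2 (as cited by Liu).

**Edition 3 (A-p19 g9, 2026-08-29; cone-edition lane #3, A-plan1 (g9) cut 05:31Z; A-p01 budget audit / A-p18 census ED-MGG-HB):** proof bodies and `set_option`
budgets only — every declaration statement and docstring byte-identical to ★ p606438.  Dead budgets of `isIrreducibleOrZero_rho_UV_of_hyp411`
(5.4 k measured) and `stub_mainGaloisGlue_of` (106 k) removed; `def411AsPrinted_uniform_of_hyp411` (205 k) and `mainGalois_datumC_of_D0` (200 k)
right-sized to 400 k; `mainGalois_D0_of` (3.51 M measured, elaborator `isDefEq` between the `RestOne` spelling of (G1)'s output and the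
`D₀`-projection spelling of (G2)/`MainGalois`; a once-only conversion via an ascribed `obtain` was measured NOT cheaper, ≥ 3.2 M) KEPT at 8 M
(≈ 2× headroom, lane convention).  The cure of record for that cost is a set of `rfl` projection lemmas `toThm418Data_Ω/_μ/_G/_rhoΩ/_omegaAt/_rhoAt` for
`Liu2021.AppendixC.Glue.toThm418Data` with (G1) restated in that spelling — a typer item, not an edition.  Proof bodies unchanged.

**Edition 4 (A-p19 g10, 2026-08-29; ED-MGG-HB, the cure itself):** the 3.51 M step of `mainGalois_D0_of` is removed by composing (G1) + (G2) ONCE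
over VARIABLES — new §2a `mainGalois_toThm418Data_rest_of_etaleItems` (generic `C`, `U`, `T`, `φ`, `ι`, `μ`, `Car`; elaborates under 40 k
heartbeats because the `RestOne`-spelling ↔ `D₀`-projection-spelling `isDefEq` now runs on small terms) — and `mainGalois_D0_of` becomes its
instantiation at `(ℭ_V, muConj 𝕌_V, 𝕋_V, AlgHom.id, ι₁, ν, CarN)`, a syntactic match (measured ∈ (200 k, 300 k]; budget 8 M → 600 k; whole file
340 s → 85 s on the farm).  Every pre-existing declaration statement and docstring is byte-identical to ★ p701298 (edition 3); one theorem added,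
no definition, no named fact.
-/

set_option autoImplicit false

noncomputable section

namespace Summit.HodgeConjecture.CorCM.Lines.A3Liu418

open scoped TensorProduct Matrix
open NumberField NumberField.InfinitePlace
open HodgeCM.Model HodgeCM.Model.LiuIndex HodgeCM.Model.TowerCarrier
open HodgeCM.Literature.Theta.LiuAlbaneseModuleDatum.D2Bridge (HcmPieces)
open Summit.HodgeConjecture.CorCM.Model
open Literature.AlgebraicGeometry.Motives (CMType)
open Literature.AlgebraicGeometry.HodgeTheory Literature.NumberTheory.Automorphic.PicardCM
open Literature.AlgebraicGeometry.ShimuraVarieties.UnitaryCanonicalModel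
open Literature.NumberTheory.ComplexMultiplication
open Literature.NumberTheory.Automorphic
open Literature.NumberTheory.Automorphic.IdeleClassGroup (toHeckeCharacter isUnitary_toHeckeCharacter galConj)
open Literature.NumberTheory.Automorphic.Liu2021 Literature.NumberTheory.Automorphic.Liu2021.AppendixC
open Literature.NumberTheory.Automorphic.Liu2021.AppendixC.RestOne
open Literature.NumberTheory.Automorphic.Liu2021.Def411WeilCarriers (lineOf locF Rep)
open Summit.HodgeConjecture.CorCM.Transposition.OmegaTransport (realUnit)
open HodgeCM.Model.ArchSideTerm (e₁)
open Literature.NumberTheory.GelbartRogawski1991 Literature.NumberTheory.GelbartRogawski1991.UnitaryDualPair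
open Literature.NumberTheory.GelbartRogawski1991.UnitaryDualPair.LocalSplitting (localMu norm_localMu continuous_localMu localMu_toLocalRing_eq_one_iff
  eq_of_forall_localMu_toHeckeCharacter_eq)
open Literature.RepresentationTheory Literature.RepresentationTheory.Liu2021
open Summit.HodgeConjecture.CorCM.Transposition
open Summit.HodgeConjecture.CorCM.D2Bridge.AdapterMuConj (muConj prop413AsPrinted_muConj def411_muConj nontrivial_omegaAt_muConj_rest)
open Summit.HodgeConjecture.CorCM.D2Bridge.MuKeyIdentEnd (hc_cm_of_printed_citations_muKey_ident)
open Summit.HodgeConjecture.CorCM.D2Bridge.MuKeyIdentLemD3End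
open Summit.HodgeConjecture.CorCM.D2Bridge.MuKeyIdentLemD3DelRecConjOmegaEnd (diagonal_frameD_map_complexConj)

open Summit.HodgeConjecture.CorCM.D2Bridge.MuKeyIdentLemD3DelRecConjOmegaEndT (hc_cm_of_printed_citations_muKey_ident_lemD3_delRecConjOmegaT)
open scoped DirectSum
open Summit.HodgeConjecture.CorCM.D2Bridge.MuKeyIdentLemD3DelRecConjOmegaEndT.PrintedCitationHypotheses (Hyp411)
open scoped DirectSum

/-! ## §1 [Def 4.11] for `V`'s family, read at the μ-UNIFORM family and at its relabelling `muConj 𝕌_V` -/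

set_option synthInstance.maxHeartbeats 400000 in
set_option maxHeartbeats 400000 in -- ed.3 (A-p19 g9): measured 205 k (A-p18 census 2026-08-29T05:05Z); was 8 000 000
/-- **[Def 4.11] at the μ-UNIFORM family.**  The pack row `Hyp411` states [Liu2021, Def 4.11] AS PRINTED for `V`'s printed rest
`restOfCharDeltaPrime … μ′ hμ′ hw′`; that rest IS the rest assembled from the μ-uniform family `𝕌_V = uniformOmegaRep … (2δ_F)⁻¹ (fun _ _ => r)` and the
one-object tail (✔ `restOfCharRep_eq_rest`, `rfl` — used as a REWRITE so that no carrier is unfolded in the kernel).  HC_CM is proved only modulo the 7 printed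
citations. [cite: Liu2021, Def. 4.11 (FJcycle.tex l. 2083–2097)] -/
theorem def411AsPrinted_uniform_of_hyp411 (h411 : Hyp411)
    (hDel : Literature.AlgebraicGeometry.ShimuraVarieties.UnitaryCanonicalModel.canonicalModel_exists_printed)
    (F : HodgeCM.CMField) [IsGalois ℚ F] (h6 : 6 ≤ Module.finrank ℚ F) {ι₁ : F →+* ℂ} (V : HodgeCM.HermSpace3 F ι₁) (a : RealScalar F)
    (Φ : CMType F) (hΦ : ι₁ ∈ Φ.1)
    (μ' : Literature.NumberTheory.Automorphic.IdeleClassGroup (F : Type) →ₜ* Circle)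
    (hμ' : IdeleClassGroup.IsConjugateSymplectic (F : Type) μ') (hw' : IdeleClassGroup.HasWeight (F : Type) μ' 1) :
    Def411AsPrinted (toThm418Data (CV hDel F V Φ) ((uniformOmegaRep (Summit.HodgeConjecture.CorCM.DelRec.exists_recordSystem_of_printed hDel) ⟨HodgeCM.CMField.K F⟩ ι₁ (⟨HodgeCM.HermSpace3.Hm V, HodgeCM.HermSpace3.isHermitian V, HodgeCM.HermSpace3.signature_ι₁ V, HodgeCM.HermSpace3.posDef_of_ne V⟩ : Summit.HodgeConjecture.CorCM.HermSpace3 ⟨HodgeCM.CMField.K F⟩ ι₁) Φ e₁ (frameD V) (frameD_real V) (frameD_ne V) (ιVE V) (2 * imagUnit (HodgeCM.CMField.K F))⁻¹ (fun _ _ => (Rep.update ↥(maximalRealSubfield (HodgeCM.CMField.K F)) (imagUnitSq (HodgeCM.CMField.K F)) (Rep.ofLineOf ↥(maximalRealSubfield (HodgeCM.CMField.K F)) (imagUnitSq (HodgeCM.CMField.K F))) (locF ↥(maximalRealSubfield (HodgeCM.CMField.K F)) (imagUnitSq (HodgeCM.CMField.K F)) (realUnit ⟨HodgeCM.CMField.K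 F⟩ a.1 a.2.1 a.2.2)) (realUnit ⟨HodgeCM.CMField.K F⟩ a.1 a.2.1 a.2.2) rfl))).rest
      (restTailOne (AlgHom.id ℚ (HodgeCM.CMField.K F)) ι₁ hμ' hw' (Def45.Carriers.ofPolDR μ' (Def45.PolDR ι₁ hμ' (Def45.RMuForm ι₁ hμ')))
        ((TV hDel F h6 V Φ).rhoΩOne (AlgHom.id ℚ (HodgeCM.CMField.K F)) ι₁ hμ' hw' (Def45.Carriers.ofPolDR μ' (Def45.PolDR ι₁ hμ' (Def45.RMuForm ι₁ hμ'))))))) := by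
  -- `V`'s printed rest at `δ′` IS the rest assembled from `𝕌_V` and the one-object tail (✔ `restOfCharRep_eq_rest`, `rfl`)
  have key : restOfCharRep (Summit.HodgeConjecture.CorCM.DelRec.exists_recordSystem_of_printed hDel) ⟨HodgeCM.CMField.K F⟩ h6 ι₁ (⟨HodgeCM.HermSpace3.Hm V, HodgeCM.HermSpace3.isHermitian V, HodgeCM.HermSpace3.signature_ι₁ V, HodgeCM.HermSpace3.posDef_of_ne V⟩ : Summit.HodgeConjecture.CorCM.HermSpace3 ⟨HodgeCM.CMField.K F⟩ ι₁) Φ e₁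
      (frameD V) (frameD_real V) (frameD_ne V) (ιVE V) (2 * imagUnit (HodgeCM.CMField.K F))⁻¹ (Rep.update ↥(maximalRealSubfield (HodgeCM.CMField.K F)) (imagUnitSq (HodgeCM.CMField.K F)) (Rep.ofLineOf ↥(maximalRealSubfield (HodgeCM.CMField.K F)) (imagUnitSq (HodgeCM.CMField.K F))) (locF ↥(maximalRealSubfield (HodgeCM.CMField.K F)) (imagUnitSq (HodgeCM.CMField.K F)) (realUnit ⟨HodgeCM.CMField.K F⟩ a.1 a.2.1 a.2.2)) (realUnit ⟨HodgeCM.CMField.K F⟩ a.1 a.2.1 a.2.2) rfl) μ' hμ' hw' =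
      (uniformOmegaRep (Summit.HodgeConjecture.CorCM.DelRec.exists_recordSystem_of_printed hDel) ⟨HodgeCM.CMField.K F⟩ ι₁ (⟨HodgeCM.HermSpace3.Hm V, HodgeCM.HermSpace3.isHermitian V, HodgeCM.HermSpace3.signature_ι₁ V, HodgeCM.HermSpace3.posDef_of_ne V⟩ : Summit.HodgeConjecture.CorCM.HermSpace3 ⟨HodgeCM.CMField.K F⟩ ι₁) Φ e₁ (frameD V) (frameD_real V) (frameD_ne V) (ιVE V) (2 * imagUnit (HodgeCM.CMField.K F))⁻¹ (fun _ _ => (Rep.update ↥(maximalRealSubfield (HodgeCM.CMField.K F)) (imagUnitSq (HodgeCM.CMField.K F)) (Rep.ofLineOf ↥(maximalRealSubfield (HodgeCM.CMField.K F)) (imagUnitSq (HodgeCM.CMField.K F))) (locF ↥(maximalRealSubfield (HodgeCM.CMField.K F)) (imagUnitSq (HodgeCM.CMField.K F)) (realUnit ⟨HodgeCM.CMField.K F⟩ a.1 a.2.1 a.2.2)) (realUnit ⟨HodgeCM.CMField.K F⟩ a.1 a.2.1 a.2.2) rfl))).rest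
      (restTailOne (AlgHom.id ℚ (HodgeCM.CMField.K F)) ι₁ hμ' hw' (Def45.Carriers.ofPolDR μ' (Def45.PolDR ι₁ hμ' (Def45.RMuForm ι₁ hμ')))
        ((TV hDel F h6 V Φ).rhoΩOne (AlgHom.id ℚ (HodgeCM.CMField.K F)) ι₁ hμ' hw' (Def45.Carriers.ofPolDR μ' (Def45.PolDR ι₁ hμ' (Def45.RMuForm ι₁ hμ'))))) :=
    restOfCharRep_eq_rest (Summit.HodgeConjecture.CorCM.DelRec.exists_recordSystem_of_printed hDel) ⟨HodgeCM.CMField.K F⟩ ι₁ (⟨HodgeCM.HermSpace3.Hm V, HodgeCM.HermSpace3.isHermitian V, HodgeCM.HermSpace3.signature_ι₁ V, HodgeCM.HermSpace3.posDef_of_ne V⟩ : Summit.HodgeConjecture.CorCM.HermSpace3 ⟨HodgeCM.CMField.K F⟩ ι₁) Φ e₁ (frameD V)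
      (frameD_real V) (frameD_ne V) (ιVE V) (2 * imagUnit (HodgeCM.CMField.K F))⁻¹ (fun _ _ => (Rep.update ↥(maximalRealSubfield (HodgeCM.CMField.K F)) (imagUnitSq (HodgeCM.CMField.K F)) (Rep.ofLineOf ↥(maximalRealSubfield (HodgeCM.CMField.K F)) (imagUnitSq (HodgeCM.CMField.K F))) (locF ↥(maximalRealSubfield (HodgeCM.CMField.K F)) (imagUnitSq (HodgeCM.CMField.K F)) (realUnit ⟨HodgeCM.CMField.K F⟩ a.1 a.2.1 a.2.2)) (realUnit ⟨HodgeCM.CMField.K F⟩ a.1 a.2.1 a.2.2) rfl)) h6 μ' hμ' hw'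
  have h := h411 hDel F h6 V a Φ hΦ μ' hμ' hw'
  dsimp only [restOfCharDeltaPrime] at h
  rw [key] at h
  exact h

/-- **Every summand `ω_{muConj 𝕌_V}(μ′, ε, χ) = ω_V(μ′ᶜ, ε, χ)` of the relabelled family is irreducible or zero** — [Def 4.11] (`Hyp411`) at the label
`μ′ᶜ` (✔ `IsConjugateSymplectic.galConj`, ✔ `HasWeight.galConj_complexConj`). [cite: Liu2021, Def. 4.11 (FJcycle.tex l. 2092–2096); Rem. 4.4] -/
theorem isIrreducibleOrZero_rho_UV_of_hyp411 (h411 : Hyp411)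
    (hDel : Literature.AlgebraicGeometry.ShimuraVarieties.UnitaryCanonicalModel.canonicalModel_exists_printed)
    (F : HodgeCM.CMField) [IsGalois ℚ F] (h6 : 6 ≤ Module.finrank ℚ F) {ι₁ : F →+* ℂ} (V : HodgeCM.HermSpace3 F ι₁) (a : RealScalar F)
    (Φ : CMType F) (hΦ : ι₁ ∈ Φ.1)
    (μ' : Literature.NumberTheory.Automorphic.IdeleClassGroup (F : Type) →ₜ* Circle)
    (hμ' : IdeleClassGroup.IsConjugateSymplectic (F : Type) μ') (hw' : IdeleClassGroup.HasWeight (F : Type) μ' 1)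
    (ε : (UV hDel F V a Φ).Eps) (χ : (UV hDel F V a Φ).Chi) :
    IsIrreducibleOrZero ((UV hDel F V a Φ).rho μ' hμ' ε χ) :=
  (def411AsPrinted_uniform_of_hyp411 h411 hDel F h6 V a Φ hΦ (galConj (IsCMField.complexConj (HodgeCM.CMField.K F)) μ') hμ'.galConj
    hw'.galConj_complexConj ε χ).1

/-! ## §2a (edition 4) MAIN + (3) at a GENERIC relabelled one-object rest — (G1) + (G2) composed once over variables -/

section Generic

variable {F₀ E₀ : Type} [Field F₀] [NumberField F₀] [IsTotallyReal F₀] [Field E₀] [NumberField E₀] [Algebra F₀ E₀]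
  [IsTotallyComplex E₀] [Algebra.IsQuadraticExtension F₀ E₀] [IsCMField E₀]
variable {P5 : PropC5Data F₀ E₀} {isotropicAt : ℕ → Prop} {C : Sec42Data P5 isotropicAt}
variable {L₀ : Type} [Field L₀] [NumberField L₀] [IsGalois ℚ L₀]

/-- **MAIN + (3) of [Liu2021, Thm 4.18] at a GENERIC relabelled one-object rest `D₀ = toThm418Data C (U.rest (restTailOne φ ι hμ hw Car (T.rhoΩOne …)))`**
(edition 4 device): from the ℓ-adic package at ONE `(ℓ, ι_ℓ)` — Betti theta decomposition [Prop 4.13], Faltings identification, [Thm 4.15] pinned at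
`μ`, Galois separation of labels — irreducibility of every summand ([Def 4.11]), one object of `𝒜(μ)` ([Prop 4.6 (1)]) and ε-rigidity under Galois
twist at `D₀`: (G1) ✔ `exists_mainIso_of_etaleItems` gives the equivariant `Φ : Ω(μ) ⊗_{M_μ} ℂ ≃ ⊕_{(ε,χ) adm} ω(μ,ε,χ)`, (G2) ✔
`Thm418Data.epsBlock_galoisAct_stable_of_epsRigid` gives item (3) for it (irreducibility at an admissible index `i` is `hirr` at the labelled
triple `⟨μ, i.ε, i.χ⟩`).  Composed over variables the `RestOne`-spelling of (G1)'s output meets the `D₀`-projection spelling of (G2) ∕ `MainGalois`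
on small terms; consumers instantiate and match syntactically.  Nothing of [Liu2021] is asserted: every item is a hypothesis.
[cite: Liu2021, Thm. 4.18 main statement + (3) (FJcycle.tex l. 2233–2243) with proof l. 2245–2290; Def. 4.11; Prop. 4.6 (1)] -/
theorem mainGalois_toThm418Data_rest_of_etaleItems (U : UniformOmega C) (T : C.HeckeTranslates) (φ : E₀ →ₐ[ℚ] L₀) (ι : L₀ →+* ℂ)
    {μ : Literature.NumberTheory.Automorphic.IdeleClassGroup E₀ →ₜ* Circle} (hμ : IdeleClassGroup.IsConjugateSymplectic E₀ μ)
    (hw : IdeleClassGroup.HasWeight E₀ μ 1) (Car : Def45.Carriers E₀ μ) (ℓ : ℕ) [Fact ℓ.Prime] (X : C.EtaleHeckeDatum ℓ)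
    (ι' : ℂ ≃+* AlgebraicClosure ℚ_[ℓ]) (hn : 3 ≤ C.n)
    (hirr : ∀ t : AdmTripleAll U, IsIrreducibleOrZero (U.rho t.μ t.hμ t.ε t.χ))
    (obj : RestOne.ObjOne φ ι hμ hw Car)
    (hB : EtaleThetaDecomposition U ℓ X ι') (hF : FaltingsIsotypic T φ ι hμ hw Car ℓ X ι')
    (h415 : Thm415Pinned C U ℓ X ι' μ hμ (RestOne.AμOne φ ι hμ hw Car obj) (RestOne.iOne φ ι hμ hw Car obj))
    (hS : GaloisLabelSeparation U φ ι hμ hw Car ℓ X ι')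
    (hGT : (toThm418Data C (U.rest (restTailOne φ ι hμ hw Car (T.rhoΩOne φ ι hμ hw Car)))).EpsRigidUnderGaloisTwist) :
    MainGalois (toThm418Data C (U.rest (restTailOne φ ι hμ hw Car (T.rhoΩOne φ ι hμ hw Car)))) := by
  -- (G1) the main isomorphism
  obtain ⟨Φm, hΦm⟩ := exists_mainIso_of_etaleItems U T φ ι hμ hw Car ℓ X ι' hn hirr obj hB hF h415 hS
  -- (G2) item (3) for it
  exact ⟨Φm, hΦm, Thm418Data.epsBlock_galoisAct_stable_of_epsRigid
    (toThm418Data C (U.rest (restTailOne φ ι hμ hw Car (T.rhoΩOne φ ι hμ hw Car))))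
    (fun i => hirr ⟨μ, hμ, hw, i.1.1, i.2, i.1.2⟩) hGT Φm hΦm⟩

end Generic

/-! ## §2 MAIN + (3) at `V`'s own datum `D₀ = toThm418Data ℭ_V ((muConj 𝕌_V).rest t_ν)` (G1 + G2) -/

set_option synthInstance.maxHeartbeats 400000 in
set_option maxHeartbeats 600000 in -- ed.4: measured ∈ (200 k, 300 k] — instantiation of §2a + the statement (was 8 000 000; 3.51 M measured through ed.3)
/-- **MAIN + (3) of [Liu2021, Thm 4.18] at `V`'s own relabelled one-object rest `D₀`**, from the ℓ-adic package at ONE `(ℓ, ι_ℓ)`, [Def 4.11] (`Hyp411`),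
`h21` (an object of `𝒜(ν)`, ✔ `Def45.nonempty_cmDatum_polDR_rMuForm_of_casselman`) and ε-rigidity at `D₀`: (G1) ✔ `exists_mainIso_of_etaleItems`, (G2) ✔
`Thm418Data.epsBlock_galoisAct_stable_of_epsRigid`.  `3 ≤ n` at `ℭ_V` is `le_refl 3`. [cite: Liu2021, Thm. 4.18 proof (FJcycle.tex l. 2245–2290); Prop. 4.6 (1)] -/
theorem mainGalois_D0_of (h21 : shimura1998_thm21_4_casselman) (h411 : Hyp411)
    (hDel : Literature.AlgebraicGeometry.ShimuraVarieties.UnitaryCanonicalModel.canonicalModel_exists_printed)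
    (F : HodgeCM.CMField) [IsGalois ℚ F] (h6 : 6 ≤ Module.finrank ℚ F) {ι₁ : F →+* ℂ} (V : HodgeCM.HermSpace3 F ι₁) (a : RealScalar F)
    (Φ : CMType F) (hΦ : ι₁ ∈ Φ.1)
    (ν : Literature.NumberTheory.Automorphic.IdeleClassGroup (F : Type) →ₜ* Circle)
    (hν : IdeleClassGroup.IsConjugateSymplectic (F : Type) ν) (hw : IdeleClassGroup.HasWeight (F : Type) ν 1)
    (hGT : (toThm418Data (CV hDel F V Φ) ((UV hDel F V a Φ).rest (restTailOne (AlgHom.id ℚ _) ι₁ hν hw (CarN F ι₁ ν hν) ((TV hDel F h6 V Φ).rhoΩOne (AlgHom.id ℚ _) ι₁ hν hw (CarN F ι₁ ν hν))))).EpsRigidUnderGaloisTwist)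
    (ℓ : ℕ) [Fact ℓ.Prime] (ι' : ℂ ≃+* AlgebraicClosure ℚ_[ℓ]) (X : (CV hDel F V Φ).EtaleHeckeDatum ℓ)
    (hB : EtaleThetaDecomposition (UV hDel F V a Φ) ℓ X ι')
    (hF : FaltingsIsotypic (TV hDel F h6 V Φ) (AlgHom.id ℚ _) ι₁ hν hw (CarN F ι₁ ν hν) ℓ X ι')
    (h415 : ∀ obj : RestOne.ObjOne (AlgHom.id ℚ _) ι₁ hν hw (CarN F ι₁ ν hν),
      Thm415Pinned (CV hDel F V Φ) (UV hDel F V a Φ) ℓ X ι' ν hν (RestOne.AμOne (AlgHom.id ℚ _) ι₁ hν hw (CarN F ι₁ ν hν) obj)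
        (RestOne.iOne (AlgHom.id ℚ _) ι₁ hν hw (CarN F ι₁ ν hν) obj))
    (hS : GaloisLabelSeparation (UV hDel F V a Φ) (AlgHom.id ℚ _) ι₁ hν hw (CarN F ι₁ ν hν) ℓ X ι') :
    MainGalois (toThm418Data (CV hDel F V Φ) ((UV hDel F V a Φ).rest (restTailOne (AlgHom.id ℚ _) ι₁ hν hw (CarN F ι₁ ν hν) ((TV hDel F h6 V Φ).rhoΩOne (AlgHom.id ℚ _) ι₁ hν hw (CarN F ι₁ ν hν))))) := by
  -- an object of `𝒜(ν)` ([Liu2021, Prop 4.6 (1)] from `h21`)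
  let obj : RestOne.ObjOne (AlgHom.id ℚ (HodgeCM.CMField.K F)) ι₁ hν hw (CarN F ι₁ ν hν) :=
    ⟨Def45.nonempty_cmDatum_polDR_rMuForm_of_casselman (σ := ι₁) (hμ := hν) hw h21⟩
  -- (G1) + (G2) at `D₀`: §2a instantiated at `(ℭ_V, muConj 𝕌_V, 𝕋_V, AlgHom.id, ι₁, ν, CarN)` (ed.4 — syntactic match, no spelling conversion)
  exact mainGalois_toThm418Data_rest_of_etaleItems (UV hDel F V a Φ) (TV hDel F h6 V Φ) (AlgHom.id ℚ (HodgeCM.CMField.K F)) ι₁ hν hw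
    (CarN F ι₁ ν hν) ℓ X ι' (le_refl _) (fun t => isIrreducibleOrZero_rho_UV_of_hyp411 h411 hDel F h6 V a Φ hΦ t.μ t.hμ t.hw t.ε t.χ) obj hB hF
    (h415 obj) hS hGT

/-! ## §3 MAIN + (3) at the transported datum `D′ = datumC …` from the same at `D₀` (G3) -/

set_option synthInstance.maxHeartbeats 400000 in
set_option maxHeartbeats 400000 in -- ed.3: measured 200 k; was 8 000 000
/-- **MAIN + (3) at `D′ = datumC …` from MAIN + (3) at `D₀`** — ✔ `mainGalois_transport_hermConj` at the END's objects (`datumC` IS that transport, by `rfl`).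
[cite: Liu2021, Thm. 4.18 main statement (FJcycle.tex l. 2233–2237) and (3) (l. 2243)] -/
theorem mainGalois_datumC_of_D0
    (hDel : Literature.AlgebraicGeometry.ShimuraVarieties.UnitaryCanonicalModel.canonicalModel_exists_printed)
    (F : HodgeCM.CMField) [IsGalois ℚ F] (h6 : 6 ≤ Module.finrank ℚ F) {ι₁ : F →+* ℂ} (V : HodgeCM.HermSpace3 F ι₁) (a : RealScalar F)
    (Φ : CMType F)
    (ν : Literature.NumberTheory.Automorphic.IdeleClassGroup (F : Type) →ₜ* Circle)
    (hν : IdeleClassGroup.IsConjugateSymplectic (F : Type) ν) (hw : IdeleClassGroup.HasWeight (F : Type) ν 1) (Φ' : CMType F)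
    (hrow : MainGalois (toThm418Data (CV hDel F V Φ) ((UV hDel F V a Φ).rest (restTailOne (AlgHom.id ℚ _) ι₁ hν hw (CarN F ι₁ ν hν) ((TV hDel F h6 V Φ).rhoΩOne (AlgHom.id ℚ _) ι₁ hν hw (CarN F ι₁ ν hν)))))) :
    MainGalois (datumC hDel F h6 V a Φ ν hν hw Φ') :=
  mainGalois_transport_hermConj (Summit.HodgeConjecture.CorCM.DelRec.exists_recordSystem_of_printed hDel) ⟨HodgeCM.CMField.K F⟩ ι₁
    (⟨HodgeCM.HermSpace3.Hm V, HodgeCM.HermSpace3.isHermitian V, HodgeCM.HermSpace3.signature_ι₁ V, HodgeCM.HermSpace3.posDef_of_ne V⟩ : Summit.HodgeConjecture.CorCM.HermSpace3 ⟨HodgeCM.CMField.K F⟩ ι₁)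
    Φ Φ' e₁ (frameD V) (frameD_real V) (frameD_ne V) (diagonal_frameD_map_complexConj F V) (ιVE V)
    (Rep.update ↥(maximalRealSubfield (HodgeCM.CMField.K F)) (imagUnitSq (HodgeCM.CMField.K F)) (Rep.ofLineOf ↥(maximalRealSubfield (HodgeCM.CMField.K F)) (imagUnitSq (HodgeCM.CMField.K F))) (locF ↥(maximalRealSubfield (HodgeCM.CMField.K F)) (imagUnitSq (HodgeCM.CMField.K F)) (realUnit ⟨HodgeCM.CMField.K F⟩ a.1 a.2.1 a.2.2)) (realUnit ⟨HodgeCM.CMField.K F⟩ a.1 a.2.1 a.2.2) rfl)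
    ν hν _ hrow

/-! ## §4 The face: `StubMainGaloisGlue` BY NAME from `h21` and ε-rigidity under Galois twist -/

/-- **`stub_mainGaloisGlue` CLOSED MODULO `h21` + ε-RIGIDITY UNDER GALOIS TWIST: the MAIN STATEMENT + item (3) of [Liu 2021, Thm 4.18] AT THE CONJUGATE
SPACE's TRANSPORTED DATUM `D′`, for every `hDel` and every face prefix, FROM [Def 4.11] for `V`'s family (`PrintedCitationHypotheses.Hyp411`, decl of record),
the ℓ-adic package of the skeleton (étale Hecke datum induced by the Albanese translates with its Betti theta decomposition [Prop 4.13], the Faltings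
identification, [Thm 4.15] pinned at `ν`, the Galois separation of labels) and item (2) at `D′`, GIVEN IN FRONT `h21 : shimura1998_thm21_4_casselman` (headline
binder #2; supplies `𝒜(ν) ≠ ∅`, Prop 4.6 (1)) and `hGT` = ε-rigidity under Galois twist at `V`'s own datum `D₀ = toThm418Data ℭ_V ((muConj 𝕌_V).rest t_ν)`
(row III-11, ✔ `Thm418Data.EpsRigidUnderGaloisTwist`).**  The conclusion after the two front hypotheses is the skeleton's `StubMainGaloisGlue`
(`Lines/a3-liu418.lean` v3 1b96ade3f8b6b529 :607–:621) BY NAME.  KERNEL: `ℓ := 2`, `ι_2` by ✔ `Complex.nonempty_ringEquiv_padicAlgCl`; §2 then §3.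
`SpaceIdent` and `NonIso` are carried as typed and not used.  HC_CM is proved only modulo the 7 printed citations until rung 0 closes; nothing of [Liu2021]
is asserted here.
[cite: Liu2021, Thm. 4.18 (FJcycle.tex l. 2232–2245) with proof l. 2245–2290; Def. 4.11; Prop. 4.13; Thm 4.15; Prop. 4.6 (1)]
[cite: Shimura1998, Thm. 21.4] [cite: BushnellHenniart2006, §41.2 (2)] -/
theorem stub_mainGaloisGlue_of (h21 : shimura1998_thm21_4_casselman)
    (hGT :
  ∀ (hDel : Literature.AlgebraicGeometry.ShimuraVarieties.UnitaryCanonicalModel.canonicalModel_exists_printed)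
      (F : HodgeCM.CMField) [IsGalois ℚ F] (h6 : 6 ≤ Module.finrank ℚ F) {ι₁ : F →+* ℂ} (V : HodgeCM.HermSpace3 F ι₁) (a : RealScalar F)
      (Φ : CMType F) (hΦ : ι₁ ∈ Φ.1) (ν : Literature.NumberTheory.Automorphic.IdeleClassGroup (F : Type) →ₜ* Circle)
      (hν : IdeleClassGroup.IsConjugateSymplectic (F : Type) ν) (hw : IdeleClassGroup.HasWeight (F : Type) ν 1),
      (toThm418Data (CV hDel F V Φ) ((UV hDel F V a Φ).rest (restTailOne (AlgHom.id ℚ _) ι₁ hν hw (CarN F ι₁ ν hν) ((TV hDel F h6 V Φ).rhoΩOne (AlgHom.id ℚ _) ι₁ hν hw (CarN F ι₁ ν hν))))).EpsRigidUnderGaloisTwist) :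
  Hyp411 →
  ∀ (hDel : Literature.AlgebraicGeometry.ShimuraVarieties.UnitaryCanonicalModel.canonicalModel_exists_printed)
      (F : HodgeCM.CMField) [IsGalois ℚ F] (h6 : 6 ≤ Module.finrank ℚ F) {ι₁ : F →+* ℂ} (V : HodgeCM.HermSpace3 F ι₁) (a : RealScalar F)
      (Φ : CMType F) (hΦ : ι₁ ∈ Φ.1) (ν : Literature.NumberTheory.Automorphic.IdeleClassGroup (F : Type) →ₜ* Circle)
      (hν : IdeleClassGroup.IsConjugateSymplectic (F : Type) ν) (hw : IdeleClassGroup.HasWeight (F : Type) ν 1) (Φ' : CMType F),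
      SpaceIdent hDel F h6 V Φ →
      (∀ (ℓ : ℕ) [Fact ℓ.Prime] (ι' : ℂ ≃+* AlgebraicClosure ℚ_[ℓ]), ∃ X : (CV hDel F V Φ).EtaleHeckeDatum ℓ,
          X.IsInducedBy (TV hDel F h6 V Φ) ∧ EtaleThetaDecomposition (UV hDel F V a Φ) ℓ X ι' ∧
          FaltingsIsotypic (TV hDel F h6 V Φ) (AlgHom.id ℚ _) ι₁ hν hw (CarN F ι₁ ν hν) ℓ X ι' ∧
          (∀ obj : RestOne.ObjOne (AlgHom.id ℚ _) ι₁ hν hw (CarN F ι₁ ν hν),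
              Thm415Pinned (CV hDel F V Φ) (UV hDel F V a Φ) ℓ X ι' ν hν (RestOne.AμOne (AlgHom.id ℚ _) ι₁ hν hw (CarN F ι₁ ν hν) obj)
                (RestOne.iOne (AlgHom.id ℚ _) ι₁ hν hw (CarN F ι₁ ν hν) obj)) ∧
          GaloisLabelSeparation (UV hDel F V a Φ) (AlgHom.id ℚ _) ι₁ hν hw (CarN F ι₁ ν hν) ℓ X ι') →
      NonIso (datumC hDel F h6 V a Φ ν hν hw Φ') → MainGalois (datumC hDel F h6 V a Φ ν hν hw Φ') := by
  intro h411 hDel F _ h6 ι₁ V a Φ hΦ ν hν hw Φ' _ hpack _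
  -- `ℓ := 2`, `ι_2 : ℂ ≃ ℚ_2^{ac}`
  obtain ⟨ι'⟩ := Complex.nonempty_ringEquiv_padicAlgCl 2
  obtain ⟨X, -, hB, hF, h415, hS⟩ := hpack 2 ι'
  exact mainGalois_datumC_of_D0 hDel F h6 V a Φ ν hν hw Φ'
    (mainGalois_D0_of h21 h411 hDel F h6 V a Φ hΦ ν hν hw (hGT hDel F h6 V a Φ hΦ ν hν hw) 2 ι' X hB hF h415 hS)

end Summit.HodgeConjecture.CorCM.Lines.A3Liu418

end
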